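import Mathlib
import HarnessLib
import Summits.QuantumFields.YangMills.Theses.PencilRigidity
import Summits.QuantumFields.YangMills.Theorems.PencilRigidityCurvatureKernelBoundKernelPinning

/-!
# `CurvatureKernelBound` — the axial growth bound is NECESSARY (support for stmt-QuantumFields-11687)

Support file for crux `stmt-QuantumFields-11687` (`PencilRigidity.CurvatureKernelBound`), line
`sixteen-charts-analytic-kernel`, stub E `AxialGrowth` (the residual UV datum). The crux IMPLIES the stub: if the
crux holds then, for every `W₁`-datum and EVERY kernel `K : ℝ⁴ → ℂ` continuous off `0` representing `S₁ 2` on `⁰𝒮`,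
`‖K(s e₀)‖ ≤ C s^(η−10)` on `(0, 1]` — because the crux's real kernel and `K` represent the same functional, hence
agree off `0` (`kernel_unique_of_realTensor`), and `C (1 + s^(η−10)) ≤ 2 max C 0 · s^(min η 10 − 10)` for `s ≤ 1`.
So splitting the crux as (regularity A–D) + (order E) loses nothing: given A–D the crux is EQUIVALENT to E.
[folklore]
-/

noncomputable section

open scoped BigOperators Topology SchwartzMap ComplexConjugate
open MeasureTheory Filter Set
open Literature.MathematicalPhysics.QuantumLattice Literature.MathematicalPhysics.AQFT

namespace Summit.QuantumFields.YangMills.Theorems.CurvatureKernel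

/-- **`AxialGrowth` is necessary for `CurvatureKernelBound`** (registered sub-goal `AxialGrowthNecessary` of
stmt-QuantumFields-11687): the crux implies the axial growth bound for every continuous representing kernel, by
kernel uniqueness off the origin. [folklore] -/
theorem AxialGrowthNecessary : open Literature.MathematicalPhysics.QuantumLattice Literature.MathematicalPhysics.AQFT Literature.MathematicalPhysics.QuantumFieldTheory in Summit.QuantumFields.YangMills.Theses.PencilRigidity.CurvatureKernelBound → ∀ (G : Type) [Group G] [TopologicalSpace G] [IsTopologicalGroup G] [CompactSpace G] [MeasurableSpace G] [BorelSpace G], IsCompactSimpleLieGroup G → ∀ (r : LatticeRep G) (sch : SpeciesScheme (YMSpecies G)) (S₁ : SchwingerFamily (EuclideanSpace ℝ (Fin 4))), ((∀ (n : ℕ), n ≠ 0 → ∀ (f : Fin n → SchwartzMap (EuclideanSpace ℝ (Fin 4)) ℝ) (F : SchwartzMap (Fin n → (EuclideanSpace ℝ (Fin 4))) ℂ), IsTensorOf F (fun i => ofRealTest (f i)) → IsOffDiagonal F → Filter.Tendsto (fun k : ℕ => ((latticeSchwinger r.ρ sch (fun s => s.F) k n (fun _ => r.curvature) f : ℝ)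 : ℂ)) Filter.atTop (nhds (S₁ n F))) ∧ (S₁.toLabelled.IsNormalized ∧ S₁.toLabelled.IsHermitian ∧ S₁.toLabelled.HasLinearGrowth ∧ S₁.toLabelled.IsReflectionPositive ∧ S₁.toLabelled.IsSymmetric ∧ S₁.toLabelled.HasClusterProperty) ∧ (∀ (n : ℕ) (a : (EuclideanSpace ℝ (Fin 4))) (F : SchwartzMap (Fin n → (EuclideanSpace ℝ (Fin 4))) ℂ), IsOffDiagonal F → S₁ n (translateMulti a F) = S₁ n F) ∧ (∀ (R : (EuclideanSpace ℝ (Fin 4)) ≃ₗᵢ[ℝ] (EuclideanSpace ℝ (Fin 4))), LinearMap.det (R.toLinearEquiv : (EuclideanSpace ℝ (Fin 4)) →ₗ[ℝ] (EuclideanSpace ℝ (Fin 4))) = 1 → (∀ i : Fin 4, ∃ j : Fin 4, R (EuclideanSpace.single i 1) = EuclideanSpace.single j 1 ∨ R (EuclideanSpace.single i 1) = -EuclideanSpace.single j 1) → ∀ (n : ℕ) (F : SchwartzMap (Fin n → (EuclideanSpace ℝ (Fin 4))) ℂ), IsOffDiagonal F → S₁ n (linActMulti R F) = S₁ n F) ∧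 (∃ Δ : ℝ, 0 < Δ ∧ S₁.toLabelled.HasMassGap Δ ∧ HasLatticeMassGap r sch Δ)) → ∀ (K : (EuclideanSpace ℝ (Fin 4)) → ℂ), ContinuousOn K {x : (EuclideanSpace ℝ (Fin 4)) | x ≠ 0} → (∀ F : SchwartzMap (Fin 2 → (EuclideanSpace ℝ (Fin 4))) ℂ, IsOffDiagonal F → MeasureTheory.Integrable (fun x : Fin 2 → (EuclideanSpace ℝ (Fin 4)) => K (x 0 - x 1) * F x) ∧ S₁ 2 F = ∫ x : Fin 2 → (EuclideanSpace ℝ (Fin 4)), K (x 0 - x 1) * F x) → ∃ C η : ℝ, 0 < η ∧ ∀ s : ℝ, 0 < s → s ≤ 1 → ‖K (EuclideanSpace.single 0 s)‖ ≤ C * s ^ (η - 10) := by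
  intro hcrux G i1 i2 i3 i4 i5 i6 hG r sch S₁ hW₁ K hcont hrep
  -- the crux fixes the Borel σ-algebra by `letI := borel G`; ours is (propositionally) the same
  have hm : i5 = borel G := BorelSpace.measurable_eq
  subst hm
  obtain ⟨K', C, η, hη, hcont', hbd, hrep'⟩ := hcrux G hG r sch S₁ hW₁
  -- uniqueness of continuous representing kernels off the origin: `K = K'` there
  have hKK : ∀ x : EuclideanSpace ℝ (Fin 4), x ≠ 0 → K x = ((K' x : ℝ) : ℂ) :=
    kernel_unique_of_realTensor hcont (Complex.continuous_ofReal.comp_continuousOn hcont')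
      (fun f F _ hoff _ _ => ⟨(hrep F hoff).1, (hrep' F hoff).1, by rw [← (hrep F hoff).2, ← (hrep' F hoff).2]⟩)
  refine ⟨2 * max C 0, min η 10, lt_min hη (by norm_num), fun s hs hs1 => ?_⟩
  have hx : (EuclideanSpace.single (0 : Fin 4) s : EuclideanSpace ℝ (Fin 4)) ≠ 0 := by
    intro h0
    have := congrArg (fun v : EuclideanSpace ℝ (Fin 4) => v 0) h0
    simp at this
    exact hs.ne' this
  have hns : ‖(EuclideanSpace.single (0 : Fin 4) s : EuclideanSpace ℝ (Fin 4))‖ = s := by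
    rw [PiLp.norm_single, Real.norm_eq_abs, abs_of_pos hs]
  have h1 : (1 : ℝ) ≤ s ^ (min η 10 - 10) :=
    Real.one_le_rpow_of_pos_of_le_one_of_nonpos hs hs1 (by linarith [min_le_right η 10])
  have h2 : s ^ (η - 10) ≤ s ^ (min η 10 - 10) :=
    Real.rpow_le_rpow_of_exponent_ge hs hs1 (by linarith [min_le_left η 10])
  have hC : C ≤ max C 0 := le_max_left _ _
  have hC0 : 0 ≤ max C 0 := le_max_right _ _
  have hpos : 0 ≤ 1 + s ^ (η - 10) := by positivity
  rw [hKK _ hx, Complex.norm_real, Real.norm_eq_abs]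
  calc |K' (EuclideanSpace.single 0 s)| ≤ C * (1 + ‖(EuclideanSpace.single (0 : Fin 4) s :
        EuclideanSpace ℝ (Fin 4))‖ ^ (η - 10)) := hbd _ hx
    _ = C * (1 + s ^ (η - 10)) := by rw [hns]
    _ ≤ max C 0 * (1 + s ^ (η - 10)) := mul_le_mul_of_nonneg_right hC hpos
    _ ≤ max C 0 * (s ^ (min η 10 - 10) + s ^ (min η 10 - 10)) := by gcongr
    _ = 2 * max C 0 * s ^ (min η 10 - 10) := by ring

end Summit.QuantumFields.YangMills.Theorems.CurvatureKernel

end
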